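import Mathlib
import HarnessLib
import Summits.Ventures.LatticeQCDFlow.Exactness.SUNResidualLayerContraction

/-!
# Velocities of the `SU(N)` residual layer: the one-link map `U ↦ e^{Q(U)} U` has a right-trivialised tangential derivative that is injective, for every `N`

HONEST FRAMING: exact (Metropolis-corrected) sampling algorithms for lattice gauge theory;
figures of merit are autocorrelation/cost numbers at stated couplings and volumes; no
continuum-physics claim.

Venture `LatticeQCDFlow` (cell pub-lqcd), topic `Exactness`; FANOUT row 10 (`eng-equiv`, engine
`latflow.equiv` / `latflow.flows_jax`, modules `equiv/residual.py` — `ResidualCoupling`,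
`contraction_bound` — and `flows_jax/residual_flow.py`).  NEW WORK of the cell: the first of three
files typing the EXACTNESS (a `HasJacobian` statement for the product Haar measure) of the masked
residual / stout layer for EVERY `N` — the one item of row 10's charter that the tree did not
type (the `SU(2)` rung is row 14's `SU2ResidualLayer*`; bijectivity / homeomorphism / measurable
automorphism for every `N` are `SUNResidualLayerContraction`, `SUNResidualLayerEquiv`).  The route
needs no Haar volume form on the Lie group: the layer under the engine's guard `κ < 1` is the
time-one map of the isotopy `τ ↦ (U ↦ e^{τ Q(U)} U)`, whose INVERSE family is the flow of an explicit
`C¹` tangent generator, and row 31's PROVED Jacobian formula of Lüscher (`TrivializingMaps/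
JacobianFormula.lean`, `FlowPushforwardDensity.lean`) transports product Haar along such flows.
This file supplies the one-link differential facts (no definition is introduced; nothing is
cited as a fact; no number):

* `conjTranspose_velocity_of_mem_specialUnitaryGroup` — the right-trivialised velocity
  `c′(t) c(t)ᴴ` of a differentiable curve in `SU(n)` is anti-Hermitian and traceless
  (`d/dt (c cᴴ) = 0` and Liouville's formula `d/dt det c = tr(c′ cᴴ) det c` of `WilsonFlow.lean`);
* `mul_norm_le_norm_of_hasDerivAt` — a secant bound `m ‖u(r) − u(0)‖ ≤ ‖c(r) − c(0)‖` passes to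
  derivatives: `m ‖u′‖ ≤ ‖c′‖`;
* **`residualCurve_velocity`** — for an exponent `Q` with values in `𝔰𝔲(n)` on `SU(n)`,
  `κ`-Lipschitz in the Frobenius norm there, `u ∈ SU(n)` and `X ∈ 𝔰𝔲(n)`: any differentiable curve
  `c` with `c(r) = e^{Q(e^{rX} u)} e^{rX} u` has `c′(0) c(0)ᴴ ∈ 𝔰𝔲(n)` and
  `(1 − κ) ‖X‖_F ≤ ‖c′(0)‖_F` (the tree's bi-Lipschitz bound `frobNorm_sub_le_of_residual` in the
  limit `r → 0`) — so for `κ < 1` the tangential derivative of the one-link layer is injective on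
  `𝔰𝔲(n)`;
* `suProj_add`, `suProj_smul`, **`fderiv_suProj_apply`** — Lüscher's projection `𝒫` onto `𝔰𝔲(n)` is
  `ℝ`-linear, so `fderiv ℝ 𝒫 W` is `𝒫` itself read as a continuous linear map (this is how the later
  files use `𝒫` as an operator without introducing a definition);
* **`isUnit_block_operator`** — on a finite-dimensional space, for continuous linear `P`, `B` with
  `P² = P`, `P ∘ B = B` on `range P` and `B` injective on `range P`, the block operator
  `P ∘ B ∘ P + (1 − P)` is a unit of the algebra of continuous linear endomorphisms.

Printed counterparts, NAMED ONLY: M. Lüscher, CMP 293 (2010) 899, §3; Abbott et al.,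
arXiv:2305.02402 §4.2 (residual layers); Morningstar–Peardon, PRD 69 (2004) 054501.
-/

noncomputable section

namespace Summit.Ventures.LatticeQCDFlow.Exactness

open Literature.MathematicalPhysics.QuantumFieldTheory
open Literature.MathematicalPhysics.QuantumFieldTheory.Luscher2010
open Literature.MathematicalPhysics.QuantumFieldTheory.WilsonFlow
open Filter
open scoped Matrix Matrix.Norms.Frobenius Topology

variable {n : ℕ}

/-! ## Velocities of curves in `SU(n)` -/

/-- **The right-trivialised velocity of a curve in `SU(n)` lies in `𝔰𝔲(n)`.**  If `c` is
differentiable at `t` with derivative `c′` and takes values in `SU(n)`, then `c′ c(t)ᴴ` is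
anti-Hermitian (differentiate `c cᴴ = 1`) and traceless (Liouville: `d/dt det c = tr(c′ c(t)ᴴ) · det c(t)`
with `det c ≡ 1`). -/
theorem conjTranspose_velocity_of_mem_specialUnitaryGroup {c : ℝ → Matrix (Fin n) (Fin n) ℂ}
    {c' : Matrix (Fin n) (Fin n) ℂ} {t : ℝ} (hc : HasDerivAt c c' t)
    (hmem : ∀ r, c r ∈ Matrix.specialUnitaryGroup (Fin n) ℂ) :
    (c' * (c t)ᴴ)ᴴ = -(c' * (c t)ᴴ) ∧ (c' * (c t)ᴴ).trace = 0 := by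
  have hU : ∀ r, c r * (c r)ᴴ = 1 := fun r => by
    have h := Matrix.mem_unitaryGroup_iff.mp (Matrix.mem_specialUnitaryGroup_iff.mp (hmem r)).1
    simpa only [Matrix.star_eq_conjTranspose] using h
  have hU' : ∀ r, (c r)ᴴ * c r = 1 := fun r => by
    have h := Matrix.mem_unitaryGroup_iff'.mp (Matrix.mem_specialUnitaryGroup_iff.mp (hmem r)).1
    simpa only [Matrix.star_eq_conjTranspose] using h
  have hstar : HasDerivAt (fun r => (c r)ᴴ) c'ᴴ t := hc.star
  have hprod : HasDerivAt (fun r => c r * (c r)ᴴ) (c' * (c t)ᴴ + c t * c'ᴴ) t := hc.mul hstar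
  have hconst : HasDerivAt (fun r => c r * (c r)ᴴ) 0 t := by
    have h1 : (fun r => c r * (c r)ᴴ) = fun _ => (1 : Matrix (Fin n) (Fin n) ℂ) := funext hU
    rw [h1]
    exact hasDerivAt_const t _
  have hsum : c' * (c t)ᴴ + c t * c'ᴴ = 0 := hprod.unique hconst
  refine ⟨?_, ?_⟩
  · rw [Matrix.conjTranspose_mul, Matrix.conjTranspose_conjTranspose]
    exact eq_neg_of_add_eq_zero_right hsum
  · set Y := c' * (c t)ᴴ with hY
    have hcY : HasDerivAt c (Y * c t) t := by
      have h1 : Y * c t = c' := by rw [hY, Matrix.mul_assoc, hU', Matrix.mul_one]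
      rw [h1]
      exact hc
    have hdet := hasDerivWithinAt_det_of_mul (s := Set.univ) hcY.hasDerivWithinAt
    have hdet1 : ∀ r, (c r).det = 1 := fun r => (Matrix.mem_specialUnitaryGroup_iff.mp (hmem r)).2
    have hconst' : HasDerivAt (fun r => (c r).det) 0 t := by
      have h1 : (fun r => (c r).det) = fun _ => (1 : ℂ) := funext hdet1
      rw [h1]
      exact hasDerivAt_const t _
    have huniq : Y.trace * (c t).det = 0 := (hasDerivWithinAt_univ.mp hdet).unique hconst'
    rwa [hdet1 t, mul_one] at huniq

/-- **Secant lower bounds pass to derivatives.**  If `c` and `u` are differentiable at `0` and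
`m ‖u(r) − u(0)‖ ≤ ‖c(r) − c(0)‖` for every `r`, then `m ‖u′(0)‖ ≤ ‖c′(0)‖` (compare the slopes
`r⁻¹ (u(r) − u(0)) → u′(0)` and `r⁻¹ (c(r) − c(0)) → c′(0)`). -/
theorem mul_norm_le_norm_of_hasDerivAt {E F : Type*} [NormedAddCommGroup E] [NormedSpace ℝ E]
    [NormedAddCommGroup F] [NormedSpace ℝ F] {c : ℝ → E} {u : ℝ → F} {c' : E} {u' : F}
    (hc : HasDerivAt c c' 0) (hu : HasDerivAt u u' 0) {m : ℝ}
    (h : ∀ r, m * ‖u r - u 0‖ ≤ ‖c r - c 0‖) : m * ‖u'‖ ≤ ‖c'‖ := by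
  have hc' : Tendsto (fun r : ℝ => r⁻¹ • (c (0 + r) - c 0)) (𝓝[≠] 0) (𝓝 c') :=
    hc.tendsto_slope_zero
  have hu' : Tendsto (fun r : ℝ => r⁻¹ • (u (0 + r) - u 0)) (𝓝[≠] 0) (𝓝 u') :=
    hu.tendsto_slope_zero
  have h1 : Tendsto (fun r : ℝ => m * ‖r⁻¹ • (u (0 + r) - u 0)‖) (𝓝[≠] 0) (𝓝 (m * ‖u'‖)) :=
    hu'.norm.const_mul m
  have h2 : Tendsto (fun r : ℝ => ‖r⁻¹ • (c (0 + r) - c 0)‖) (𝓝[≠] 0) (𝓝 ‖c'‖) := hc'.norm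
  refine le_of_tendsto_of_tendsto' h1 h2 fun r => ?_
  simp only [zero_add, norm_smul, norm_inv, Real.norm_eq_abs]
  calc m * (|r|⁻¹ * ‖u r - u 0‖) = |r|⁻¹ * (m * ‖u r - u 0‖) := by ring
    _ ≤ |r|⁻¹ * ‖c r - c 0‖ := mul_le_mul_of_nonneg_left (h r) (inv_nonneg.2 (abs_nonneg r))

/-! ## The one-link residual map along one-parameter subgroups -/

/-- `e^{rX} u ∈ SU(n)` for `X ∈ 𝔰𝔲(n)`, `u ∈ SU(n)`, real `r`. -/
theorem exp_smul_mul_mem_specialUnitaryGroup {u X : Matrix (Fin n) (Fin n) ℂ}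
    (hu : u ∈ Matrix.specialUnitaryGroup (Fin n) ℂ) (hX : Xᴴ = -X) (hX0 : X.trace = 0) (r : ℝ) :
    NormedSpace.exp (r • X) * u ∈ Matrix.specialUnitaryGroup (Fin n) ℂ := by
  refine Submonoid.mul_mem _ (exp_mem_specialUnitaryGroup ?_ ?_) hu
  · rw [Matrix.conjTranspose_smul, hX, star_trivial, smul_neg]
  · rw [Matrix.trace_smul, hX0, smul_zero]

/-- The one-parameter subgroup through `u`: `r ↦ e^{rX} u` has velocity `X u` at `r = 0`. -/
theorem hasDerivAt_exp_smul_mul (u X : Matrix (Fin n) (Fin n) ℂ) :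
    HasDerivAt (fun r : ℝ => NormedSpace.exp (r • X) * u) (X * u) 0 := by
  have h := (hasDerivAt_exp_smul_const' (𝕂 := ℝ) X (0 : ℝ)).mul_const u
  rw [zero_smul, NormedSpace.exp_zero, mul_one] at h
  exact h

/-- **Velocity of the one-link residual map along a tangent direction**, every `N`.  Let the
exponent `Q` take values in `𝔰𝔲(n)` on `SU(n)` and be `κ`-Lipschitz there in the Frobenius norm
(the hypotheses of `SUNResidualLayerContraction`), `u ∈ SU(n)`, `X ∈ 𝔰𝔲(n)`, and let `c` be a curve,
differentiable at `0` with derivative `c′`, which agrees with `r ↦ e^{Q(e^{rX}u)} e^{rX} u` (the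
residual map along the one-parameter subgroup through `u`).  Then (i) the right-trivialised velocity
`c′ c(0)ᴴ` lies in `𝔰𝔲(n)` (the curve stays in `SU(n)`), and (ii) `(1 − κ) ‖X‖_F ≤ ‖c′‖_F` — the
tree's bound `(1 − κ)‖U − V‖_F ≤ ‖e^{QU}U − e^{QV}V‖_F` in the limit.  For `κ < 1` this makes the
tangential derivative of the one-link layer injective on `𝔰𝔲(n)`; no differentiability of `Q` off
the curve is assumed. -/
theorem residualCurve_velocity {Q : Matrix (Fin n) (Fin n) ℂ → Matrix (Fin n) (Fin n) ℂ} {κ : ℝ}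
    (hQ : ∀ U ∈ Matrix.specialUnitaryGroup (Fin n) ℂ, (Q U)ᴴ = -Q U ∧ (Q U).trace = 0)
    (hlip : ∀ U ∈ Matrix.specialUnitaryGroup (Fin n) ℂ, ∀ V ∈ Matrix.specialUnitaryGroup (Fin n) ℂ,
      frobNorm (Q U - Q V) ≤ κ * frobNorm (U - V))
    {u X : Matrix (Fin n) (Fin n) ℂ} (hu : u ∈ Matrix.specialUnitaryGroup (Fin n) ℂ)
    (hX : Xᴴ = -X) (hX0 : X.trace = 0)
    {c : ℝ → Matrix (Fin n) (Fin n) ℂ} {c' : Matrix (Fin n) (Fin n) ℂ} (hc : HasDerivAt c c' 0)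
    (hcdef : ∀ r : ℝ, c r = NormedSpace.exp (Q (NormedSpace.exp (r • X) * u)) *
      (NormedSpace.exp (r • X) * u)) :
    ((c' * (c 0)ᴴ)ᴴ = -(c' * (c 0)ᴴ) ∧ (c' * (c 0)ᴴ).trace = 0) ∧
      (1 - κ) * frobNorm X ≤ frobNorm c' := by
  have hγmem : ∀ r : ℝ, NormedSpace.exp (r • X) * u ∈ Matrix.specialUnitaryGroup (Fin n) ℂ :=
    exp_smul_mul_mem_specialUnitaryGroup hu hX hX0
  have hcmem : ∀ r, c r ∈ Matrix.specialUnitaryGroup (Fin n) ℂ := fun r => by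
    rw [hcdef]
    exact residual_value_mem hQ (hγmem r)
  refine ⟨conjTranspose_velocity_of_mem_specialUnitaryGroup hc hcmem, ?_⟩
  have hγ : HasDerivAt (fun r : ℝ => NormedSpace.exp (r • X) * u) (X * u) 0 :=
    hasDerivAt_exp_smul_mul u X
  have hbound : ∀ r : ℝ, (1 - κ) * ‖NormedSpace.exp (r • X) * u - NormedSpace.exp ((0 : ℝ) • X) * u‖
      ≤ ‖c r - c 0‖ := by
    intro r
    rw [← frobNorm_eq_norm, ← frobNorm_eq_norm, hcdef r, hcdef 0]
    exact frobNorm_sub_le_of_residual hQ hlip (hγmem r) (hγmem 0)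
  have h := mul_norm_le_norm_of_hasDerivAt hc hγ hbound
  rwa [← frobNorm_eq_norm, ← frobNorm_eq_norm,
    frobNorm_mul_unitary X (Matrix.mem_specialUnitaryGroup_iff.mp hu).1] at h

/-! ## Lüscher's projection `𝒫` as a continuous linear map -/

/-- `𝒫` is additive. -/
theorem suProj_add (A B : Matrix (Fin n) (Fin n) ℂ) : suProj (A + B) = suProj A + suProj B := by
  ext i j
  simp only [suProj_def, Matrix.sub_apply, Matrix.add_apply, Matrix.smul_apply,
    Matrix.conjTranspose_apply, Matrix.trace_sub, Matrix.trace_add, Matrix.trace_conjTranspose,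
    smul_eq_mul, star_add]
  ring

/-- `𝒫` is `ℝ`-homogeneous. -/
theorem suProj_smul (r : ℝ) (A : Matrix (Fin n) (Fin n) ℂ) : suProj (r • A) = r • suProj A := by
  ext i j
  simp only [suProj_def, Matrix.sub_apply, Matrix.smul_apply, Matrix.conjTranspose_apply,
    Matrix.trace_sub, Matrix.trace_smul, Matrix.trace_conjTranspose, smul_eq_mul,
    Complex.real_smul, star_mul', Complex.star_def, Complex.conj_ofReal]
  ring

/-- **`fderiv ℝ 𝒫 W = 𝒫`**: the projection is `ℝ`-linear, so its Fréchet derivative at any point,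
applied to `X`, is `𝒫 X`.  (This lets the sequel files use `fderiv ℝ suProj 0` as THE continuous
linear operator `𝒫` without introducing a definition.) -/
theorem fderiv_suProj_apply (W X : Matrix (Fin n) (Fin n) ℂ) :
    fderiv ℝ (suProj (n := n)) W X = suProj X := by
  let L : Matrix (Fin n) (Fin n) ℂ →ₗ[ℝ] Matrix (Fin n) (Fin n) ℂ :=
    { toFun := suProj, map_add' := suProj_add, map_smul' := suProj_smul }
  let Lc : Matrix (Fin n) (Fin n) ℂ →L[ℝ] Matrix (Fin n) (Fin n) ℂ := LinearMap.toContinuousLinearMap L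
  have hL : HasFDerivAt (suProj (n := n)) Lc W := Lc.hasFDerivAt
  rw [hL.fderiv]
  rfl

/-- `𝒫` fixes exactly `𝔰𝔲(n)`: `𝒫 X = X` iff `X` is anti-Hermitian and traceless. -/
theorem suProj_eq_self_iff (X : Matrix (Fin n) (Fin n) ℂ) :
    suProj X = X ↔ Xᴴ = -X ∧ X.trace = 0 := by
  refine ⟨fun h => ?_, fun h => suProj_eq_self h.1 h.2⟩
  constructor
  · rw [← h, conjTranspose_suProj]
  · rw [← h, trace_suProj]

/-! ## A block operator is a unit when its diagonal block is injective -/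

/-- **Block operators.**  On a finite-dimensional real normed space let `P`, `B` be continuous
linear maps with `P ∘ P = P`, `P (B x) = B x` and `B x = 0 → x = 0` for every `x` in the range of
`P` (`P x = x`).  Then `T = P ∘ B ∘ P + (1 − P)` is a UNIT of the algebra `E →L[ℝ] E`: if
`T x = 0` then applying `P` gives `B (P x) = 0`, so `P x = 0` and `x = T x = 0`; an injective
endomorphism of a finite-dimensional space is bijective, and the inverse is continuous. -/
theorem isUnit_block_operator {E : Type*} [NormedAddCommGroup E] [NormedSpace ℝ E]
    [FiniteDimensional ℝ E] (P B : E →L[ℝ] E) (hPP : ∀ x, P (P x) = P x)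
    (hB : ∀ x, P x = x → P (B x) = B x) (hinj : ∀ x, P x = x → B x = 0 → x = 0) :
    IsUnit (P.comp (B.comp P) + (ContinuousLinearMap.id ℝ E - P)) := by
  haveI : CompleteSpace E := FiniteDimensional.complete ℝ E
  set T := P.comp (B.comp P) + (ContinuousLinearMap.id ℝ E - P) with hT
  have hTx : ∀ x, T x = P (B (P x)) + (x - P x) := fun x => rfl
  have hker : ∀ x, T x = 0 → x = 0 := by
    intro x hx
    have h1 : P (T x) = B (P x) := by
      rw [hTx, map_add, map_sub, hPP, hPP, sub_self, add_zero, hB (P x) (hPP x)]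
    rw [hx, map_zero] at h1
    have h2 : P x = 0 := hinj (P x) (hPP x) h1.symm
    have h3 : T x = x := by rw [hTx, h2, map_zero, map_zero, zero_add, sub_zero]
    rw [← h3, hx]
  have hkerbot : LinearMap.ker (T : E →ₗ[ℝ] E) = ⊥ :=
    LinearMap.ker_eq_bot'.2 fun x hx => hker x hx
  have hinjT : Function.Injective (T : E →ₗ[ℝ] E) := LinearMap.ker_eq_bot.1 hkerbot
  have hsurjT : Function.Surjective (T : E →ₗ[ℝ] E) :=
    LinearMap.injective_iff_surjective.1 hinjT
  have hrange : LinearMap.range (T : E →ₗ[ℝ] E) = ⊤ := LinearMap.range_eq_top.2 hsurjT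
  let e : E ≃L[ℝ] E := ContinuousLinearEquiv.ofBijective T hkerbot hrange
  have he : ∀ x, e x = T x := fun x => rfl
  refine ⟨⟨T, (e.symm : E →L[ℝ] E), ?_, ?_⟩, rfl⟩
  · ext x
    change T (e.symm x) = x
    rw [← he, e.apply_symm_apply]
  · ext x
    change e.symm (T x) = x
    rw [← he, e.symm_apply_apply]

end Summit.Ventures.LatticeQCDFlow.Exactness

end
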